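import Summits.BirchSwinnertonDyer.BirchSwinnertonDyer.Theorems.SylvesterTwoHeegnerIndexCMHalfTowerInvolution
import Summits.BirchSwinnertonDyer.BirchSwinnertonDyer.Theorems.SylvesterTwoHeegnerIndexCMHalfThmCOfFixing
import Literature.NumberTheory.EllipticCurves.HasseWeilGoodReductionFrobeniusProofs
import HarnessLib

/-!
# (T′) of crux `UpperOffV0HSYPlus` (stmt-BirchSwinnertonDyer-19804), skeleton VARIANT M: `stub_thmC` — THEOREM C (item
# 19802) MODULO {`Dt` of degree 6, #19} AND THE BOTTOM (W2-b): «every involution of the decomposition group at `w ∣ 3`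
# fixes Hu–Shu–Yin's CM point `y₁ ∈ W₀(K[9p])`»

Planner D525 (3)(a) / D531 (#T, #S10).  #T (p686942) displays the tower fixing at `n = 1` as `hTF₁`: an involution `s ≠ 1` of
`K[9p]/K` fixing `∛3, ∛p, y₁`.  By #S10c part 1 (p689572) and a local Frobenius at `v ∋ 3` the involution `s` is CONSTRUCTED
(`s := r₀(res σ_v)⁹`: an involution since the image of `Γ_{K_v}` has order `∣ 18`, `≠ 1` by its restriction to `K[p]` (k-ty1 #21a),
fixing `∛3, ∛p` automatically), so `hTF₁` follows from the pure Shimura-reciprocity statement at the bottom,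

  `hW2b₁` : every `τ ∈ Γ_{K_v}` (`v ∋ 3`) acting on the embedded `K[9p]` as an involution `s` fixes `y₁`

(memo two §15.5 (C-b)/(C-c) = §67.2 (W2-b) at `n = 1`: `σ_{−1}·P₀ = P₀`; Shimura reciprocity on `X₀(243)` + the 3-adic identity
`ρ(√−3) ∈ ℚ₃^×·U₃`, kernel-certified residue step p452301; NOT print, NOT in the tree, desk (M-K3-7)).

* `towerFixing_one_of_involutionFixing (Dt) : hW2b₁ → hTF₁` (the bottom half of #S10c's `decompFixing_of_involutionFixing`);
* **`thmC_of_named_of_involutionFixing (Dt) (hdeg) (hD) (hW2b₁) : PublishedFactsTwoPlus → SylvesterTwoNonneg.HSYPointTwoDivisibleSevenModNine`**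
  (`stub_thmC`'s type VERBATIM; = p686942 `thmC_of_named_of_fixing` ∘ the above);
* `theses_hsyPointTwoDivisibleSevenModNine_of_named_of_involutionFixing` — ITEM 19802's ROUTE DECL, CONDITIONAL on
  {`Dt`, #19, the display (bsd), `hW2b₁`}.

HONEST LABEL: CONDITIONAL; `hW2b₁` is the unrefereed cell content of THEOREM C; items 19802/19804 stay OPEN; no stub closed;
X12.CMAtTwo NOT proved; BSD is not proved by any of this, for any curve.  `--supports stmt-BirchSwinnertonDyer-19804 --as helper`.
-/

set_option linter.dupNamespace false
set_option autoImplicit false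

noncomputable section

open scoped Classical Pointwise

namespace Summit.BirchSwinnertonDyer.BirchSwinnertonDyer.Theorems.SylvesterTwoCMHalf

open WeierstrassCurve Field NumberField IsDedekindDomain IsDedekindDomain.HeightOneSpectrum Finset Module
open Literature.NumberTheory.EllipticCurves Literature.NumberTheory.GaloisRepresentations
  Literature.NumberTheory.EllipticCurves.ModularForms
  Literature.NumberTheory.EllipticCurves.HuShuYin2019
  Literature.NumberTheory.EllipticCurves.KolyvaginCocycle
  Literature.NumberTheory.EllipticCurves.RingClassField
  Summit.BirchSwinnertonDyer.BirchSwinnertonDyer.Theses.SylvesterTwoHeegnerIndex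
  Summit.BirchSwinnertonDyer.BirchSwinnertonDyer.Theorems
  Summit.BirchSwinnertonDyer.BirchSwinnertonDyer.Theorems.SylvesterTwoCMData
  Summit.BirchSwinnertonDyer.BirchSwinnertonDyer.Theorems.SylvesterTwoCMFlip
  Summit.BirchSwinnertonDyer.Rank1Residual.X11b Summit.BirchSwinnertonDyer.Rank1Residual.X11b.RingClassTower

set_option maxHeartbeats 1600000 in
/-- **The tower fixing at `n = 1` from the bottom (W2-b).**  For every `p ≡ 7 (9)`, `K ∋ ω`, `ι`, `∛3, ∛p, y₁ ∈ W₀(K[9p])` over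
`Dt.φ(τ_{Q_p})`: an involution `s ≠ 1` of `K[9p]/K` with `s ∛3 = ∛3`, `s ∛p = ∛p`, `s·y₁ = y₁` — namely `s := r₀(res σ_v)⁹` for a local
Frobenius `σ_v` at `v ∋ 3`, granted `hW2b₁`. [cite: NeukirchANT1999, Ch. II §9 Prop. (9.6)] [cite: Cox2013, §9.A (9.1), Cor. 5.21]
[cite: HuShuYin2019, §2.2 Prop. 2.4, §3 p. 8, §4.1 p. 10] -/
theorem towerFixing_one_of_involutionFixing
    (Dt : ModularParametrizationData (⟨0, 0, 1, 0, -1⟩ : WeierstrassCurve ℚ) 243)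
    (hW2b₁ : ∀ (p : ℕ), p.Prime → p % 9 = 7 → ∀ (K : Type) [Field K] [NumberField K] (ω : K), ω ^ 2 + ω + 1 = 0 →
      Module.finrank ℚ K = 2 → ∀ (ι : K →+* ℂ) (v : HeightOneSpectrum (𝓞 K)), ((3 : ℕ) : 𝓞 K) ∈ v.asIdeal →
      ∀ (e : ringClassField K ι (9 * p) →+* AlgebraicClosure K),
        (∀ k : K, e (algebraMap K (ringClassField K ι (9 * p)) k) = algebraMap K (AlgebraicClosure K) k) →
      ∀ (y₁ : ((⟨0, 0, 1, 0, -1⟩ : WeierstrassCurve ℚ).baseChange (ringClassField K ι (9 * p))).toAffine.Point),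
        Affine.Point.map (W' := (⟨0, 0, 1, 0, -1⟩ : WeierstrassCurve ℚ)) (ringClassField K ι (9 * p)).subtype.toRatAlgHom y₁ =
          Dt.φ (heegnerTau (81 * ((p : ℤ) ^ 2 + 4 * p + 16), -(9 * (4 * (p : ℤ) ^ 2 + 17 * p + 72)), 4 * (p : ℤ) ^ 2 + 18 * p + 81)) →
      ∀ (τ : absoluteGaloisGroup (v.adicCompletion K)) (s : ringClassField K ι (9 * p) ≃ₐ[K] ringClassField K ι (9 * p)),
        (∀ x : ringClassField K ι (9 * p), (show AlgebraicClosure K ≃ₐ[K] AlgebraicClosure K from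
          resGal (K := K) (v.adicCompletion K) τ) (e x) = e (s x)) → s * s = 1 →
        pointGalHom (⟨0, 0, 1, 0, -1⟩ : WeierstrassCurve ℚ) (ringClassField K ι (9 * p)) (s.restrictScalars ℚ) y₁ = y₁) :
    ∀ (p : ℕ), p.Prime → p % 9 = 7 → ∀ (K : Type) [Field K] [NumberField K] (ω : K), ω ^ 2 + ω + 1 = 0 →
      Module.finrank ℚ K = 2 → ∀ (ι : K →+* ℂ) (c₃ cp : ringClassField K ι (9 * p)), c₃ ^ 3 = 3 →
      cp ^ 3 = (p : ringClassField K ι (9 * p)) →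
      ∀ (y₁ : ((⟨0, 0, 1, 0, -1⟩ : WeierstrassCurve ℚ).baseChange (ringClassField K ι (9 * p))).toAffine.Point),
        Affine.Point.map (W' := (⟨0, 0, 1, 0, -1⟩ : WeierstrassCurve ℚ)) (ringClassField K ι (9 * p)).subtype.toRatAlgHom y₁ =
          Dt.φ (heegnerTau (81 * ((p : ℤ) ^ 2 + 4 * p + 16), -(9 * (4 * (p : ℤ) ^ 2 + 17 * p + 72)), 4 * (p : ℤ) ^ 2 + 18 * p + 81)) →
      ∃ s : ringClassField K ι (9 * p) ≃ₐ[K] ringClassField K ι (9 * p), s ≠ 1 ∧ s * s = 1 ∧ s c₃ = c₃ ∧ s cp = cp ∧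
        pointGalHom (⟨0, 0, 1, 0, -1⟩ : WeierstrassCurve ℚ) (ringClassField K ι (9 * p)) (s.restrictScalars ℚ) y₁ = y₁ := by
  intro p hp hp7 K _ _ ω hω h2 ι c₃ cp hc₃ hcp y₁ hy₁
  have hK := JZero.isImaginaryQuadratic_of_sq_add_self_add_one hω h2
  have hp3 : p % 3 = 1 := by omega
  have hp0 : p ≠ 0 := hp.ne_zero
  have hp3' : ¬ 3 ∣ p := fun h ↦ by have := Nat.mod_eq_zero_of_dvd h; omega
  have h9p0 : 9 * p ≠ 0 := mul_ne_zero (by norm_num) hp0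
  haveI := (finiteDimensional_and_isGalois_ringClassField hK ι h9p0).1
  haveI := (finiteDimensional_and_isGalois_ringClassField hK ι h9p0).2
  haveI := (finiteDimensional_and_isGalois_ringClassField hK ι hp0).1
  haveI := (finiteDimensional_and_isGalois_ringClassField hK ι hp0).2
  -- ### the place `v₀ ∋ 3`, a local Frobenius `σ`, the global Frobenius `F = res σ`
  obtain ⟨v₀, hv₀⟩ := exists_heightOneSpectrum_three_mem (K := K)
  obtain ⟨𝔐, h𝔐⟩ := v₀.localPrimesAbove_nonempty
  obtain ⟨σ, hσ⟩ := v₀.exists_isArithFrobAt_localAbsIntegers h𝔐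
  have h𝔓 := v₀.primeBelow_mem_primesAbove (ι := closureEmb (K := K) (v₀.adicCompletion K)) h𝔐
  set F : absoluteGaloisGroup K := resGal (K := K) (v₀.adicCompletion K) σ with hFdef
  have hF : IsArithFrobAt (𝓞 K) F (v₀.primeBelow (closureEmb (K := K) (v₀.adicCompletion K)) 𝔐) :=
    isArithFrobAt_resGalOfEmb h𝔐 (closureEmb (K := K) (v₀.adicCompletion K)) hσ
  have hres9 : resGal (K := K) (v₀.adicCompletion K) (σ ^ 9) = F ^ 9 := map_pow _ σ 9
  -- ### an embedding of `K[9p]`, its restriction, and `s := r₀(F)⁹`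
  obtain ⟨emb, hembK, -⟩ := exists_coherent_emb (K := K) ι
  obtain ⟨r₀, hr₀, hr₀surj, -⟩ := exists_restrictHom hK ι h9p0 (emb (9 * p)) (hembK _)
  obtain ⟨P₀, hP₀, hP₀mem⟩ := exists_decompositionBound_three_of_dvd hω h2 ι hp hp3 hp3' (dvd_refl p) v₀ hv₀
    (emb (9 * p)) (hembK _) r₀ hr₀ hr₀surj
  set s : ringClassField K ι (9 * p) ≃ₐ[K] ringClassField K ι (9 * p) := r₀ (F ^ 9) with hsdef
  have hs9 : s = r₀ F ^ 9 := map_pow r₀ F 9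
  have hs2 : s * s = 1 := by
    have h18 : r₀ F ^ 18 = 1 :=
      orderOf_dvd_iff_pow_eq_one.mp ((Subgroup.orderOf_dvd_natCard P₀ (hP₀mem σ)).trans hP₀)
    rw [hs9, ← pow_add]; exact h18
  have hss : ∀ x, s (s x) = x := fun x ↦ by rw [← AlgEquiv.mul_apply, hs2, AlgEquiv.one_apply]
  -- ### `s ≠ 1`: its restriction to `K[p]` is the Frobenius involution `≠ 1` (k-ty1 #21a)
  have hlep : ringClassField K ι p ≤ ringClassField K ι (9 * p) := ringClassField_mono hK ι (Dvd.intro_left 9 rfl) h9p0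
  set ep : ringClassField K ι p →+* AlgebraicClosure K := (emb (9 * p)).comp (RingClassField.inclusion ι hlep) with hepdef
  have hep : ∀ k : K, ep (algebraMap K (ringClassField K ι p) k) = algebraMap K (AlgebraicClosure K) k := fun k ↦ by
    show emb (9 * p) (RingClassField.inclusion ι hlep (algebraMap K (ringClassField K ι p) k)) = _
    rw [(RingClassField.inclusion ι hlep).commutes, hembK]
  obtain ⟨rp, hrp, -, -⟩ := exists_restrictHom hK ι hp0 ep hep
  obtain ⟨σ₀, -, hσ₀1, hσ₀2, hσ₀F⟩ := JZero.exists_involution_apply_emb_eq_of_isArithFrobAt_three hω h2 ι v₀ hv₀ hp3' hp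
    hp3 (dvd_refl p) ep hep h𝔓 hF
  have hrpF : ∀ x, rp F x = σ₀ x := fun x ↦ ep.injective (by rw [← hrp]; exact hσ₀F x)
  have hrpF9 : rp F ^ 9 = rp F := by
    have h2' : rp F ^ 2 = 1 := by
      refine AlgEquiv.ext fun x ↦ ?_
      rw [pow_two, AlgEquiv.mul_apply, hrpF, hrpF, ← AlgEquiv.mul_apply, hσ₀2]; rfl
    rw [show (9 : ℕ) = 2 * 4 + 1 from rfl, pow_succ, pow_mul, h2', one_pow, one_mul]
  have hincl : ∀ (g : absoluteGaloisGroup K) (x : ringClassField K ι p),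
      r₀ g (RingClassField.inclusion ι hlep x) = RingClassField.inclusion ι hlep (rp g x) :=
    restrictHom_apply_inclusion hK ι hp0 hlep ep hep rp hrp (emb (9 * p)) (hembK _) r₀ hr₀
  have hs1 : s ≠ 1 := by
    intro h1
    apply hσ₀1
    refine AlgEquiv.ext fun x ↦ ?_
    have hx := hincl (F ^ 9) x
    rw [← hsdef, h1, AlgEquiv.one_apply, map_pow, hrpF9, hrpF] at hx
    rw [AlgEquiv.one_apply]
    exact ((RingClassField.inclusion ι hlep).injective hx).symm
  -- ### `s` fixes `∛3, ∛p` (part 1 §2) and `y₁` (the displayed (W2-b) at the bottom)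
  have hω' : (algebraMap K (ringClassField K ι (9 * p)) ω) ^ 2 + algebraMap K (ringClassField K ι (9 * p)) ω + 1 = 0 := by
    have h := congrArg (algebraMap K (ringClassField K ι (9 * p))) hω
    rwa [map_add, map_add, map_pow, map_one, map_zero] at h
  have hsω : s.toRingEquiv (algebraMap K (ringClassField K ι (9 * p)) ω) = algebraMap K (ringClassField K ι (9 * p)) ω :=
    s.commutes ω
  have hss' : ∀ x, s.toRingEquiv (s.toRingEquiv x) = x := hss
  have hs3 : s c₃ = c₃ :=
    apply_eq_self_of_sq_of_pow_three_eq hω' s.toRingEquiv hss' hsω hc₃ (by exact map_ofNat s 3) three_ne_zero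
  have hsp : s cp = cp :=
    apply_eq_self_of_sq_of_pow_three_eq hω' s.toRingEquiv hss' hsω hcp (by exact map_natCast s p)
      (Nat.cast_ne_zero.mpr hp0)
  have hsy : pointGalHom (⟨0, 0, 1, 0, -1⟩ : WeierstrassCurve ℚ) (ringClassField K ι (9 * p)) (s.restrictScalars ℚ) y₁ = y₁ :=
    hW2b₁ p hp hp7 K ω hω h2 ι v₀ hv₀ (emb (9 * p)) (hembK _) y₁ hy₁ (σ ^ 9) s (fun x ↦ by rw [hres9]; exact hr₀ _ x) hs2
  exact ⟨s, hs1, hs2, hs3, hsp, hsy⟩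

/-- **`stub_thmC` MODULO {`Dt` of degree 6, #19, (W2-b) at the bottom}** — THEOREM C (★) in the skeleton's typing
`PublishedFactsTwoPlus → SylvesterTwoNonneg.HSYPointTwoDivisibleSevenModNine` (VARIANT M l.187, VERBATIM after the displayed
binders): p686942 `thmC_of_named_of_fixing` fed with `towerFixing_one_of_involutionFixing`.  CONDITIONAL; item 19802 stays open
on the ledger; BSD is not proved by any of this. [cite: HuShuYin2019, display (bsd) p. 12, §3 p. 8] [cite: GrossLMS1991, §3–§4] -/
theorem thmC_of_named_of_involutionFixing
    (Dt : ModularParametrizationData (⟨0, 0, 1, 0, -1⟩ : WeierstrassCurve ℚ) 243) (hdeg : Dt.deg = 6)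
    (hD : shaAnPair_mul_height_eq_two_zpow_mul_height_named)
    (hW2b₁ : ∀ (p : ℕ), p.Prime → p % 9 = 7 → ∀ (K : Type) [Field K] [NumberField K] (ω : K), ω ^ 2 + ω + 1 = 0 →
      Module.finrank ℚ K = 2 → ∀ (ι : K →+* ℂ) (v : HeightOneSpectrum (𝓞 K)), ((3 : ℕ) : 𝓞 K) ∈ v.asIdeal →
      ∀ (e : ringClassField K ι (9 * p) →+* AlgebraicClosure K),
        (∀ k : K, e (algebraMap K (ringClassField K ι (9 * p)) k) = algebraMap K (AlgebraicClosure K) k) →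
      ∀ (y₁ : ((⟨0, 0, 1, 0, -1⟩ : WeierstrassCurve ℚ).baseChange (ringClassField K ι (9 * p))).toAffine.Point),
        Affine.Point.map (W' := (⟨0, 0, 1, 0, -1⟩ : WeierstrassCurve ℚ)) (ringClassField K ι (9 * p)).subtype.toRatAlgHom y₁ =
          Dt.φ (heegnerTau (81 * ((p : ℤ) ^ 2 + 4 * p + 16), -(9 * (4 * (p : ℤ) ^ 2 + 17 * p + 72)), 4 * (p : ℤ) ^ 2 + 18 * p + 81)) →
      ∀ (τ : absoluteGaloisGroup (v.adicCompletion K)) (s : ringClassField K ι (9 * p) ≃ₐ[K] ringClassField K ι (9 * p)),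
        (∀ x : ringClassField K ι (9 * p), (show AlgebraicClosure K ≃ₐ[K] AlgebraicClosure K from
          resGal (K := K) (v.adicCompletion K) τ) (e x) = e (s x)) → s * s = 1 →
        pointGalHom (⟨0, 0, 1, 0, -1⟩ : WeierstrassCurve ℚ) (ringClassField K ι (9 * p)) (s.restrictScalars ℚ) y₁ = y₁) :
    PublishedFactsTwoPlus → SylvesterTwoNonneg.HSYPointTwoDivisibleSevenModNine :=
  thmC_of_named_of_fixing Dt hdeg hD (towerFixing_one_of_involutionFixing Dt hW2b₁)

/-- **Item 19802's ROUTE DECL `Theses.SylvesterTwoHeegnerIndex.HSYPointTwoDivisibleSevenModNine` MODULO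
{`Dt` of degree 6, #19, Hu–Shu–Yin's display (bsd), (W2-b) at the bottom}**.  CONDITIONAL; the item stays open; BSD is not
proved by any of this. [cite: HuShuYin2019, display (bsd) p. 12, §3 p. 8] [cite: GrossLMS1991, §3–§4] -/
theorem theses_hsyPointTwoDivisibleSevenModNine_of_named_of_involutionFixing
    (Dt : ModularParametrizationData (⟨0, 0, 1, 0, -1⟩ : WeierstrassCurve ℚ) 243) (hdeg : Dt.deg = 6)
    (hD : shaAnPair_mul_height_eq_two_zpow_mul_height_named) (hH : shaAnPair_mul_height_eq_two_zpow_mul_height)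
    (hW2b₁ : ∀ (p : ℕ), p.Prime → p % 9 = 7 → ∀ (K : Type) [Field K] [NumberField K] (ω : K), ω ^ 2 + ω + 1 = 0 →
      Module.finrank ℚ K = 2 → ∀ (ι : K →+* ℂ) (v : HeightOneSpectrum (𝓞 K)), ((3 : ℕ) : 𝓞 K) ∈ v.asIdeal →
      ∀ (e : ringClassField K ι (9 * p) →+* AlgebraicClosure K),
        (∀ k : K, e (algebraMap K (ringClassField K ι (9 * p)) k) = algebraMap K (AlgebraicClosure K) k) →
      ∀ (y₁ : ((⟨0, 0, 1, 0, -1⟩ : WeierstrassCurve ℚ).baseChange (ringClassField K ι (9 * p))).toAffine.Point),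
        Affine.Point.map (W' := (⟨0, 0, 1, 0, -1⟩ : WeierstrassCurve ℚ)) (ringClassField K ι (9 * p)).subtype.toRatAlgHom y₁ =
          Dt.φ (heegnerTau (81 * ((p : ℤ) ^ 2 + 4 * p + 16), -(9 * (4 * (p : ℤ) ^ 2 + 17 * p + 72)), 4 * (p : ℤ) ^ 2 + 18 * p + 81)) →
      ∀ (τ : absoluteGaloisGroup (v.adicCompletion K)) (s : ringClassField K ι (9 * p) ≃ₐ[K] ringClassField K ι (9 * p)),
        (∀ x : ringClassField K ι (9 * p), (show AlgebraicClosure K ≃ₐ[K] AlgebraicClosure K from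
          resGal (K := K) (v.adicCompletion K) τ) (e x) = e (s x)) → s * s = 1 →
        pointGalHom (⟨0, 0, 1, 0, -1⟩ : WeierstrassCurve ℚ) (ringClassField K ι (9 * p)) (s.restrictScalars ℚ) y₁ = y₁) :
    Summit.BirchSwinnertonDyer.BirchSwinnertonDyer.Theses.SylvesterTwoHeegnerIndex.HSYPointTwoDivisibleSevenModNine :=
  theses_hsyPointTwoDivisibleSevenModNine_of_named_of_fixing Dt hdeg hD hH (towerFixing_one_of_involutionFixing Dt hW2b₁)

end Summit.BirchSwinnertonDyer.BirchSwinnertonDyer.Theorems.SylvesterTwoCMHalf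

end
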